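import Summits.HodgeConjecture.HodgeConjecture.Theorems.SymbolClassesAlgebraic.Negative.LoadBearing
import Summits.HodgeConjecture.HodgeConjecture.Theorems.MilnorKExponentialSymbolLiftRReduction
import Literature.Barriers.HodgeConjecture.GeneralizedHodgeTrivialReasonsEllipticCurveCubedModel
import Literature.Barriers.HodgeConjecture.GeneralizedHodgeTrivialReasonsEllipticCurveCubedRational
import Literature.NumberTheory.Transcendental.DeRhamTheoremProofs
import Literature.AlgebraicGeometry.HodgeTheory.HodgeTypeConjugation
import Literature.AlgebraicGeometry.HodgeTheory.AbelJacobiPullbackHodgeSection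
import Literature.AlgebraicGeometry.HodgeTheory.AlgebraicClassesHodgeTypeHolds
import Literature.Geometry.Kaehler.ComplexTorusHodgeDecomposition

/-!
# `SymbolClassesAlgebraic` (stmt-HodgeConjecture-17743) · Negative · the transcendental witness, and the load-bearing lemmas made unconditional

Negative knowledge for the crux `MilnorKExponential.SymbolClassesAlgebraic` (GK_p), from the standing
disprover's work file `Cruxes/SymbolClassesAlgebraic/Disproof.lean` (§11). `Negative/LoadBearing.lean`
(gen 1) proved that the clauses `m ≠ 0` and "the open sets cover `X^an`" of the crux are load-bearing
MODULO a witness it could not build: a smooth projective variety with, next to a symbol-normalised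
model, a RATIONAL class that is NOT ALGEBRAIC. This file constructs the witness on the tree's own
carriers and discharges both lemmas.

* `hodgePQ_two_one_one_ne_top` — on every complex torus charted on `ℂ³`, `H^{1,1} ⊊ H²_dR`: the
  invariant form `dz₀ ∧ dz₁` has type `(2,0)`, its class is non-zero (Lange–Birkenhake Prop. 1.1.20,
  the tree's `ComplexTorus.cconstClassEquiv`) and lies in `H^{2,0}`, which meets `H^{1,1}` in `0`
  (`ComplexTorus.eq_zero_of_mem_hodgePQ_of_ne`). No definition is introduced (the form is built
  inside the proof).
* `exists_isRationalClass_not_isOfHodgeType` — **there is a smooth projective complex threefold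
  with a RATIONAL class in `H²` which is NOT of Hodge type `(1,1)`**: `X = E_i × E_i × E_i`, the tree's
  algebraic model `cubeScheme` of the torus `ℂ³/(ℤ + iℤ)³` (`isSmoothProjective_cubeScheme`,
  `isAnalytification_torusMap`, `hodgeModelOfAnalytification` with de Rham's theorem
  `exists_complexDeRhamIsoFamily_holds`). If every rational class were of type `(1,1)`, then — rational
  classes spanning `H²(X(ℂ); ℂ)` (`exists_basis_isRationalClass`), the type being read in any model
  (`isOfHodgeType_iff_mem_hodgePQ`) and `A^*` being onto — `H^{1,1}` of the torus would be everything.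
  No explicit period computation is needed: the statement is invariant under the free scalar of the
  comparison.
* `exists_isRationalClass_not_mem_algebraicClasses` — hence (algebraic classes are of type `(p,p)`,
  `isOfHodgeType_of_mem_algebraicClasses_of_isSmoothProjective`) a rational NON-ALGEBRAIC class in
  `H²` of a smooth projective threefold: the Hodge conjecture's hypothesis "of type `(p,p)`" is not
  idle, certified on the tree's carriers.
* `exists_loadBearingWitness` — with the landed existence of symbol-normalised models
  (`SymbolLiftR.normalisedModelsExist`, degree `2 ≤ 2·3`) this is exactly the witness `hw` of
  `Negative/LoadBearing.lean`; so
* `symbolClassesAlgebraic_false_without_nonzero'`, `symbolClassesAlgebraic_false_without_cover'` —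
  **the crux with `m ≠ 0` deleted, resp. with the covering clause deleted, is FALSE, unconditionally**
  (refuted natural weakenings of the crux: any proof of GK must use both clauses).
Refuter seat refuter-cdisprove-stmt-HodgeConjecture-17743-g2-0 (cdisprove gen 2, cycle 1), 2026-08-17.
-/

noncomputable section

-- The mandated namespace `Summit.<P>.<Sub>.Theorems.…` repeats `HodgeConjecture` (single-conjunct summit).
set_option linter.dupNamespace false

namespace Summit.HodgeConjecture.HodgeConjecture.Theorems.SymbolClassesAlgebraic.Negative.TranscendentalWitness

open scoped Manifold ComplexConjugate
open Literature.AlgebraicGeometry.HodgeTheory Literature.AlgebraicGeometry.Motives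
  Literature.Geometry.Kaehler Literature.NumberTheory.Transcendental
open Literature.Barriers.HodgeConjecture
open Summit.HodgeConjecture.HodgeConjecture.Theorems.SymbolLiftR (normalisedModelsExist)
open Summit.HodgeConjecture.HodgeConjecture.Theorems.SymbolClassesAlgebraic.Negative.LoadBearing

/-! ### On a complex torus charted on `ℂ³`, `H^{1,1} ≠ H²_dR` -/

/-- **`H^{1,1}(T) ⊊ H²_dR(T; ℂ)` for every complex torus `T = ℂ³/Λ`**: the invariant form
`η = dz₀ ∧ dz₁` (the alternation of `(u, u') ↦ z₀(u) z₁(u')`, built inside the proof) has type `(2,0)`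
(`η(e^{iθ}u, e^{iθ}u') = e^{2iθ} η(u, u')`), so its class lies in `H^{2,0}`
(`ComplexTorus.cconstClass_mem_hodgePQ`), and it is non-zero (`η(e₀, e₁) = 1`; invariant forms represent
distinct classes, Lange–Birkenhake Prop. 1.1.20 = `ComplexTorus.cconstClassEquiv`); were `H^{1,1}`
everything, the class would lie in two distinct Hodge pieces, hence vanish
(`ComplexTorus.eq_zero_of_mem_hodgePQ_of_ne`). [cite: LangeBirkenhake1992, §1.1.5 Prop. 1.1.23] -/
theorem hodgePQ_two_one_one_ne_top {ι : Type*} [Fintype ι] (Φ : (ι → ℝ) ≃L[ℝ] (Fin 3 → ℂ)) :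
    hodgePQ (Fin 3 → ℂ) (ComplexTorus Φ) 2 1 1 ≠ ⊤ := by
  -- the bilinear form `(u, u') ↦ z₀(u) z₁(u')` and its alternation `η = dz₀ ∧ dz₁`
  set B : ContinuousMultilinearMap ℝ (fun _ : Fin 2 ↦ (Fin 3 → ℂ)) ℂ :=
    (ContinuousMultilinearMap.mkPiAlgebraFin ℝ 2 ℂ).compContinuousLinearMap fun i ↦
      ![(ContinuousLinearMap.proj (R := ℂ) (φ := fun _ : Fin 3 ↦ ℂ) 0).restrictScalars ℝ,
        (ContinuousLinearMap.proj (R := ℂ) (φ := fun _ : Fin 3 ↦ ℂ) 1).restrictScalars ℝ] i with hB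
  have hBv : ∀ v : Fin 2 → (Fin 3 → ℂ), B v = v 0 0 * v 1 1 := fun v ↦ by
    simp [hB, ContinuousMultilinearMap.mkPiAlgebraFin_apply]
  set η : (Fin 3 → ℂ) [⋀^Fin 2]→L[ℝ] ℂ := ContinuousMultilinearMap.alternatization B with hηdef
  have hηv : ∀ v : Fin 2 → (Fin 3 → ℂ), η v = v 0 0 * v 1 1 - v 1 0 * v 0 1 := by
    intro v
    simp only [hηdef, ContinuousMultilinearMap.alternatization_apply_apply]
    have huniv : (Finset.univ : Finset (Equiv.Perm (Fin 2))) = {1, Equiv.swap 0 1} := by decide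
    rw [huniv, Finset.sum_pair (by decide)]
    simp [hBv, Equiv.Perm.sign_swap', Units.smul_def, sub_eq_add_neg]
  -- `η` has type `(2, 0)` …
  have htype : ComplexTorus.IsConstOfType (k := 2) 2 0 η := by
    refine ⟨rfl, fun θ v ↦ ?_⟩
    rw [hηv, hηv]
    have h : Complex.exp ((((2 : ℕ) : ℤ) - (0 : ℕ) : ℤ) * θ * Complex.I) =
        Complex.exp (θ * Complex.I) * Complex.exp (θ * Complex.I) := by
      rw [← Complex.exp_add]
      congr 1
      push_cast
      ring
    rw [h]
    simp only [Pi.smul_apply, smul_eq_mul]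
    ring
  -- … and is non-zero: `η(e₀, e₁) = 1`
  have hne : η ≠ 0 := by
    intro h
    have h1 : η ![Pi.single 0 1, Pi.single 1 1] = 1 := by
      rw [hηv]
      simp
    rw [h] at h1
    exact zero_ne_one h1
  -- if `H^{1,1}` were everything, `[η] ∈ H^{2,0} ∩ H^{1,1} = 0`
  intro htop
  have h20 : ComplexTorus.cconstClass Φ η ∈ hodgePQ (Fin 3 → ℂ) (ComplexTorus Φ) 2 2 0 :=
    ComplexTorus.cconstClass_mem_hodgePQ Φ htype
  have h11 : ComplexTorus.cconstClass Φ η ∈ hodgePQ (Fin 3 → ℂ) (ComplexTorus Φ) 2 1 1 := by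
    rw [htop]; exact Submodule.mem_top
  have h0 : ComplexTorus.cconstClass Φ η = 0 :=
    ComplexTorus.eq_zero_of_mem_hodgePQ_of_ne Φ (rfl : 2 + 0 = 2) (rfl : 1 + 1 = 2) (by decide) h20 h11
  refine hne ((ComplexTorus.cconstClassEquiv Φ (k := 2)).injective ?_)
  rw [ComplexTorus.cconstClassEquiv_apply, h0, map_zero]

/-! ### The witness: a rational class of `H²(E_i³)` not of type `(1,1)`, hence not algebraic -/

/-- **A smooth projective complex threefold with a rational class in `H²` NOT of Hodge type
`(1,1)`**: `E_i³ = cubeScheme i`, the tree's algebraic model of `ℂ³/(ℤ + iℤ)³`. On the Hodge model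
with carrier the torus (`hodgeModelOfAnalytification`, de Rham's theorem
`exists_complexDeRhamIsoFamily_holds`), if every rational class were of type `(1,1)` then, rational
classes spanning `H²(X(ℂ); ℂ)` (`exists_basis_isRationalClass`), the type being testable in this model
(`isOfHodgeType_iff_mem_hodgePQ`) and `A^*` being onto (`HodgeModel.pullback_surjective`), the piece
`H^{1,1}` of the torus would be all of `H²_dR` — contradicting `hodgePQ_two_one_one_ne_top`.
[cite: LangeBirkenhake1992, §1.1.5 Prop. 1.1.23] [cite: VoisinHodgeI2002, §7.1.1 and §11.3.1] -/
theorem exists_isRationalClass_not_isOfHodgeType :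
    ∃ (X : SchemeOver ℂ) (c : complexBetti X 2),
      IsSmoothProjective 3 X ∧ IsRationalClass c ∧ ¬ IsOfHodgeType 3 X 2 1 1 c := by
  have hτ : Complex.I.im ≠ 0 := by simp
  obtain ⟨e, he⟩ := exists_complexDeRhamIsoFamily_holds (Fin 3 → ℂ)
  have hX : IsSmoothProjective 3 (cubeScheme Complex.I hτ) := isSmoothProjective_cubeScheme Complex.I hτ
  let A : HodgeModel 3 (cubeScheme Complex.I hτ) :=
    hodgeModelOfAnalytification Complex.I hτ (torusMap Complex.I hτ) (isAnalytification_torusMap Complex.I hτ) e he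
  suffices h : ∃ c : complexBetti (cubeScheme Complex.I hτ) 2,
      IsRationalClass c ∧ ¬ IsOfHodgeType 3 (cubeScheme Complex.I hτ) 2 1 1 c by
    obtain ⟨c, hc, hn⟩ := h
    exact ⟨_, c, hX, hc, hn⟩
  by_contra hall
  push Not at hall
  -- every rational class pulls back into `H^{1,1}` of the torus model …
  have hrat : ∀ c : complexBetti (cubeScheme Complex.I hτ) 2, IsRationalClass c →
      A.pullback 2 c ∈ A.hodgePQ 2 1 1 :=
    fun c hc ↦ (isOfHodgeType_iff_mem_hodgePQ hX A c).1 (hall c hc)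
  -- … hence every class does (rational classes span)
  obtain ⟨r, b, hb⟩ := exists_basis_isRationalClass hX 2
  have hallc : ∀ c : complexBetti (cubeScheme Complex.I hτ) 2, A.pullback 2 c ∈ A.hodgePQ 2 1 1 := by
    intro c
    have hc : c ∈ Submodule.span ℂ (Set.range b) := by rw [b.span_eq]; exact Submodule.mem_top
    refine Submodule.span_induction (fun x hx ↦ ?_) ?_ (fun x y _ _ hx hy ↦ ?_) (fun a x _ hx ↦ ?_) hc
    · obtain ⟨i, rfl⟩ := hx
      exact hrat _ (hb i)
    · rw [map_zero]; exact Submodule.zero_mem _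
    · rw [map_add]; exact Submodule.add_mem _ hx hy
    · rw [map_smul]; exact Submodule.smul_mem _ a hx
  -- so `H^{1,1}` of the torus is everything
  refine hodgePQ_two_one_one_ne_top (periodIso Complex.I hτ) (eq_top_iff.2 fun y _ ↦ ?_)
  obtain ⟨c, hc⟩ := A.pullback_surjective 2 (e (EllipticCurveCubedTorus Complex.I hτ) 2 y)
  have h : e (EllipticCurveCubedTorus Complex.I hτ) 2 y ∈
      (hodgePQ (Fin 3 → ℂ) (EllipticCurveCubedTorus Complex.I hτ) 2 1 1).map
        (e (EllipticCurveCubedTorus Complex.I hτ) 2).toLinearMap := by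
    rw [← hc]; exact hallc c
  obtain ⟨y', hy', hyy'⟩ := Submodule.mem_map.1 h
  obtain rfl : y' = y := (e (EllipticCurveCubedTorus Complex.I hτ) 2).injective hyy'
  exact hy'

/-- **A rational NON-ALGEBRAIC class on a smooth projective complex variety, on the tree's
carriers**: the class of `exists_isRationalClass_not_isOfHodgeType` is not in
`algebraicClasses X 1 = N¹ H²`, algebraic classes being of type `(p,p)`
(`isOfHodgeType_of_mem_algebraicClasses_of_isSmoothProjective`). The Hodge-type hypothesis of the Hodge
conjecture is not idle. [cite: VoisinHodgeI2002, §11.1.2 Prop. 11.20 and §11.3.1] -/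
theorem exists_isRationalClass_not_mem_algebraicClasses :
    ∃ (X : SchemeOver ℂ) (c : complexBetti X (2 * 1)),
      IsSmoothProjective 3 X ∧ IsRationalClass c ∧ c ∉ algebraicClasses X 1 := by
  obtain ⟨X, c, hX, hc, hn⟩ := exists_isRationalClass_not_isOfHodgeType
  exact ⟨X, c, hX, hc, fun ha ↦ hn (isOfHodgeType_of_mem_algebraicClasses_of_isSmoothProjective hX 1 ha)⟩

/-- **The witness of `Negative/LoadBearing.lean`, discharged**: a smooth projective variety, a
symbol-normalised Hodge model in degree `2` (`SymbolLiftR.normalisedModelsExist`, `0 + 1 ≤ 3`) and a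
rational class of `H²` outside `algebraicClasses X (0 + 1)`. [cite: VoisinHodgeI2002, Thm. 7.10 (proof) and §11.3.1] -/
theorem exists_loadBearingWitness :
    ∃ (n : ℕ) (X : SchemeOver ℂ) (q : ℕ) (A : HodgeModel n X) (c : complexBetti X (2 * (q + 1))),
      IsSmoothProjective n X ∧ A.IsSymbolNormalized q ∧ IsRationalClass c ∧
        c ∉ algebraicClasses X (q + 1) := by
  obtain ⟨X, c, hX, hc, hn⟩ := exists_isRationalClass_not_mem_algebraicClasses
  obtain ⟨A, hA⟩ := normalisedModelsExist hX 0 (by norm_num)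
  exact ⟨3, X, 0, A, c, hX, hA, hc, hn⟩

/-! ### The load-bearing lemmas, unconditional -/

/-- **`m ≠ 0` is load-bearing — unconditionally.** The crux with the clause `m ≠ 0` deleted from its
symbol-cocycle hypothesis is FALSE: `(σ, θ, m) = (0, 0, 0)` is then a symbol cocycle for every class
(`hasSymbolCocycle_without_nonzero`), in particular for the rational non-algebraic class of
`exists_loadBearingWitness` next to its normalised model. [cite: VoisinHodgeI2002, §11.3.1] -/
theorem symbolClassesAlgebraic_false_without_nonzero' :
    ¬ (∀ ⦃n : ℕ⦄ ⦃X : SchemeOver ℂ⦄, IsSmoothProjective n X →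
        ∀ (q : ℕ) (c : complexBetti X (2 * (q + 1))), IsRationalClass c →
          (∃ A : HodgeModel n X, A.IsSymbolNormalized q ∧
            ∃ (ι : Type) (_ : Fintype ι) (U : ι → Set A.carrier) (hU : ∀ i, IsOpen (U i))
              (_ : ∀ x, ∃ i, x ∈ U i)
              (σ : (Fin (q + 2) → ι) → ((Fin (q + 1) → (A.carrier → ℂ)) →₀ ℤ))
              (_ : IsMilnorSymbolCocycle A.model U σ)
              (θ : cclosedSmoothForms A.model A.carrier (2 * q + 1 + 1)) (m : ℤ),
              IsTransgression hU q (fun J ↦ symbolForm A.model (q + 1) (σ J)) θ ∧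
                A.deRham A.carrier (2 * q + 1 + 1)
                    (complexDeRhamCohomology.mk A.model A.carrier (2 * q + 1 + 1) θ) =
                  (m : ℂ) • A.pullback (2 * q + 1 + 1) c) →
          c ∈ algebraicClasses X (q + 1)) :=
  symbolClassesAlgebraic_false_without_nonzero exists_loadBearingWitness

/-- **The covering clause is load-bearing — unconditionally.** The crux with `∀ x, ∃ i, x ∈ U i`
deleted is FALSE: over the EMPTY cover every closed form is a transgression and every class a symbol
class with `m = 1` (`hasSymbolCocycle_without_cover`), in particular the rational non-algebraic class
of `exists_loadBearingWitness`. [cite: BottTu1982Forms, §8 Prop. 8.8] [cite: VoisinHodgeI2002, §11.3.1] -/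
theorem symbolClassesAlgebraic_false_without_cover' :
    ¬ (∀ ⦃n : ℕ⦄ ⦃X : SchemeOver ℂ⦄, IsSmoothProjective n X →
        ∀ (q : ℕ) (c : complexBetti X (2 * (q + 1))), IsRationalClass c →
          (∃ A : HodgeModel n X, A.IsSymbolNormalized q ∧
            ∃ (ι : Type) (_ : Fintype ι) (U : ι → Set A.carrier) (hU : ∀ i, IsOpen (U i))
              (σ : (Fin (q + 2) → ι) → ((Fin (q + 1) → (A.carrier → ℂ)) →₀ ℤ))
              (_ : IsMilnorSymbolCocycle A.model U σ)
              (θ : cclosedSmoothForms A.model A.carrier (2 * q + 1 + 1)) (m : ℤ),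
              m ≠ 0 ∧ IsTransgression hU q (fun J ↦ symbolForm A.model (q + 1) (σ J)) θ ∧
                A.deRham A.carrier (2 * q + 1 + 1)
                    (complexDeRhamCohomology.mk A.model A.carrier (2 * q + 1 + 1) θ) =
                  (m : ℂ) • A.pullback (2 * q + 1 + 1) c) →
          c ∈ algebraicClasses X (q + 1)) :=
  symbolClassesAlgebraic_false_without_cover exists_loadBearingWitness

end Summit.HodgeConjecture.HodgeConjecture.Theorems.SymbolClassesAlgebraic.Negative.TranscendentalWitness

end
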